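import Mathlib
import Literature.MathematicalPhysics.QuantumLattice.GrassmannIntegralProofs

/-!
# Stub `stub_noCompactWilsonMode` of line `crossing-split-integrability`
(crux `Summit.QuantumFields.QCD.Theses.PauliWegnerSea.PhaseQuenchedFlavourDecay`, item stmt-QuantumFields-9151)

**Wilson fermions have no compactly supported modes — for ANY gauge field.**

Let `D_W = wilsonDirac ρ U m 1` be the tree's `r = 1` Wilson–Dirac matrix on the torus `(ℤ/L)⁴`
(any group `G`, any matrix representation `ρ`, any configuration `U`, any real mass `m`) and let
`ψ` be a fermion field such that

* (slab support) for two distinct directions `μ ≠ ν` and residues `a, b : ZMod L`, `ψ` vanishes at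
  every site `x` with `x μ ∈ {a, a+1}` or `x ν ∈ {b, b+1}` (i.e. the support does not wrap around
  the torus in the directions `μ, ν` — on `ℤ⁴` this is "finite extent in two directions"), and
* (locality of the equation) `D_W ψ` vanishes at every site where `ψ` vanishes — which is the case
  for every eigenvector of `D_W + V` with `V` ANY site-diagonal operator (twisted mass `−E γ₅`,
  i.e. eigenvectors of the Hermitian `H_W = γ₅ D_W`, chemical potential, clover term, random
  on-site potential, …).

Then `ψ = 0` (`stub_noCompactWilsonMode`).  In particular `D_W`, `H_W = γ₅ D_W` and all their
on-site perturbations have NO eigenvector supported in a slab, for every background: no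
"Aharonov–Bohm cage", no compacton, no flat band of compact states — however the link variables are
chosen (random `Z₃` fluxes included).

Proof (three lines of γ-algebra).  Let `S` be the set of sites carrying `ψ`; take `x ∈ S` with
maximal `μ`-height and, among those, maximal `ν`-height (heights read in the window opened by the
two empty layers).  (1) The equation at the empty site `x + μ̂` sees only the backward hop from `x`:
`(1 + γ_μ) ρ(U(x,μ))⁻¹ ψ(x) = 0`, so `γ_μ ψ(x) = −ψ(x)` (colour matrix invertible).  (2) The equation
at the empty site `x + ν̂` sees the backward hops from `x` and from `x' = x + ν̂ − μ̂` only: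
`(1 + γ_ν) ρ(U(x,ν))⁻¹ ψ(x) + (1 + γ_μ) ρ(U(x',μ))⁻¹ ψ(x') = 0`.  (3) Multiply by `(1 − γ_μ)`: the
second term dies (`(1 − γ_μ)(1 + γ_μ) = 0`, Wilson's `r = 1` projectors), and on a spinor with
`γ_μ χ = −χ` one has `(1 − γ_μ)(1 + γ_ν) χ = χ + γ_ν χ − γ_μ χ − γ_μ γ_ν χ = 2χ` by `{γ_μ, γ_ν} = 0`;
hence `ψ(x) = 0`, contradicting `x ∈ S`.

Role (lead c8, crux NOTES.md §1): at `β → −∞` the SU(3) Wilson prior is a random nowhere-zero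
`Z₃`-flux ensemble; the one mechanism making the open core X(ε > 0) fail there outright (flavour
without degenerate partner) is an ATOM at zero of the local eigenvalue law = compact zero modes of
`H_W(M*)` with positive density — excluded here for every flux pattern; and the sibling crux K1's
named threat "compactly supported zero mode of `D_W` (non-abelian Aharonov–Bohm cage)"
(stmt-QuantumFields-11510, CHEAPEST FALSIFIER) does not exist.  Reusable: `wilsonDirac_one_mulVec_apply`.
-/

noncomputable section

namespace Summit.QuantumFields.QCD.Cruxes.PhaseQuenchedFlavourDecay.CrossingSplitIntegrability

open Matrix Finset
open Literature.Probability.LatticeModels (TorusSite)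
open Literature.MathematicalPhysics.QuantumFieldTheory
open Literature.MathematicalPhysics.QuantumLattice

section NoCompactMode

variable {L N : ℕ} [NeZero L] {G : Type*} [Group G] (ρ : G →* Matrix (Fin N) (Fin N) ℂ)

/-! ### Torus bookkeeping: the backward shift `x − μ̂ = x - Pi.single μ 1` -/

omit [NeZero L] in
/-- `(x − μ̂) + μ̂ = x`. -/
theorem shift_sub_single (x : TorusSite 4 L) (μ : Fin 4) : Site.shift (x - Pi.single μ 1) μ = x := by
  simp [Site.shift]

omit [NeZero L] in
/-- `(x + μ̂) − μ̂ = x`. -/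
theorem shift_sub_single' (x : TorusSite 4 L) (μ : Fin 4) : Site.shift x μ - Pi.single μ 1 = x := by
  simp [Site.shift]

omit [NeZero L] in
/-- `y = z + μ̂ ↔ z = y − μ̂`. -/
theorem eq_shift_iff_eq_sub_single (y z : TorusSite 4 L) (μ : Fin 4) :
    y = Site.shift z μ ↔ z = y - Pi.single μ 1 := by
  constructor
  · rintro rfl; exact (shift_sub_single' z μ).symm
  · rintro rfl; exact (shift_sub_single y μ).symm

omit [NeZero L] in
/-- The shifted coordinate. -/
theorem shift_apply_same (x : TorusSite 4 L) (μ : Fin 4) : Site.shift x μ μ = x μ + 1 := by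
  simp [Site.shift]

omit [NeZero L] in
/-- The other coordinates do not move under a shift. -/
theorem shift_apply_of_ne (x : TorusSite 4 L) {μ κ : Fin 4} (h : κ ≠ μ) :
    Site.shift x μ κ = x κ := by
  simp [Site.shift, h]

omit [NeZero L] in
/-- The other coordinates do not move under a backward shift. -/
theorem sub_single_apply_of_ne (x : TorusSite 4 L) {μ κ : Fin 4} (h : κ ≠ μ) :
    (x - Pi.single μ 1 : TorusSite 4 L) κ = x κ := by
  simp [h]

/-! ### The site form of `D_W ψ` -/

/-- **Site form of the Wilson operator (`r = 1`) applied to a field.**  For every site `y`, colour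
`c` and spin `s`:
`(D_W ψ)(y,c,s) = (m+4) ψ(y,c,s) − ½ Σ_μ [ Σ_{b,β} (1−γ_μ)_{sβ} ρ(U(y,μ))_{cb} ψ(y+μ̂,b,β)
  + Σ_{b,β} (1+γ_μ)_{sβ} ρ(U(y−μ̂,μ)⁻¹)_{cb} ψ(y−μ̂,b,β) ]` (note `ρ` of the GROUP inverse on the
backward hop, as in the tree's definition). [folklore] -/
theorem wilsonDirac_one_mulVec_apply (U : GaugeConfig 4 L G) (m : ℝ)
    (ψ : TorusSite 4 L × Fin N × Fin 4 → ℂ) (y : TorusSite 4 L) (c : Fin N) (s : Fin 4) :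
    (wilsonDirac ρ U m 1 *ᵥ ψ) (y, c, s) =
      ((m + 4 : ℝ) : ℂ) * ψ (y, c, s) -
        (1 / 2 : ℂ) * ∑ μ : Fin 4,
          (∑ b : Fin N, ∑ β : Fin 4,
              ((1 : Matrix (Fin 4) (Fin 4) ℂ) - euclideanGamma μ) s β * ρ (U (y, μ)) c b *
                ψ (Site.shift y μ, b, β) +
            ∑ b : Fin N, ∑ β : Fin 4,
              ((1 : Matrix (Fin 4) (Fin 4) ℂ) + euclideanGamma μ) s β *
                  ρ (U ((y - Pi.single μ 1), μ))⁻¹ c b *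
                ψ ((y - Pi.single μ 1), b, β)) := by
  rw [Matrix.mulVec, dotProduct]
  simp only [wilsonDirac, Matrix.of_apply, Complex.ofReal_one, one_smul, mul_one, sub_mul,
    Finset.sum_sub_distrib]
  congr 1
  · -- diagonal part
    simp only [ite_mul, zero_mul, Finset.sum_ite_eq, Finset.mem_univ, if_true]
  · -- hopping part
    simp only [mul_assoc, ← Finset.mul_sum]
    congr 1
    simp only [Finset.sum_mul]
    rw [Finset.sum_comm]
    refine Finset.sum_congr rfl fun μ _ => ?_
    simp only [add_mul, Finset.sum_add_distrib]
    congr 1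
    · -- forward hop: the sum over sites collapses at `y + μ̂`
      rw [Fintype.sum_prod_type]
      simp only [ite_mul, zero_mul]
      simp_rw [Finset.sum_ite_irrel, Finset.sum_const_zero]
      rw [Finset.sum_ite_eq']
      simp only [Finset.mem_univ, if_true]
      rw [Fintype.sum_prod_type]
      refine Finset.sum_congr rfl fun b _ => Finset.sum_congr rfl fun β _ => ?_
      ring
    · -- backward hop: `y = z + μ̂ ↔ z = y − μ̂`
      rw [Fintype.sum_prod_type]
      simp only [ite_mul, zero_mul, eq_shift_iff_eq_sub_single]
      simp_rw [Finset.sum_ite_irrel, Finset.sum_const_zero]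
      rw [Finset.sum_ite_eq']
      simp only [Finset.mem_univ, if_true]
      rw [Fintype.sum_prod_type]
      refine Finset.sum_congr rfl fun b _ => Finset.sum_congr rfl fun β _ => ?_
      ring



/-- `(1 − γ_μ)(1 + γ_μ) = 0` — Wilson's `r = 1` hopping projectors are complementary. -/
theorem one_sub_gamma_mul_one_add_gamma (μ : Fin 4) :
    ((1 : Matrix (Fin 4) (Fin 4) ℂ) - euclideanGamma μ) * (1 + euclideanGamma μ) = 0 := by
  rw [sub_mul, one_mul, mul_add, mul_one, euclideanGamma_mul_self]
  abel

/-- On spinors with `γ_μ W = −W`: `(1 − γ_μ)(1 + γ_ν) W = 2 W` for `μ ≠ ν` (by `{γ_μ, γ_ν} = 0`). -/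
theorem one_sub_gamma_mul_one_add_gamma_mul_of_neg {n : Type*} [Fintype n] {μ ν : Fin 4}
    (hμν : μ ≠ ν) (W : Matrix (Fin 4) n ℂ) (hW : euclideanGamma μ * W = -W) :
    ((1 : Matrix (Fin 4) (Fin 4) ℂ) - euclideanGamma μ) * ((1 + euclideanGamma ν) * W) =
      (2 : ℂ) • W := by
  have h1 : euclideanGamma μ * (euclideanGamma ν * W) = euclideanGamma ν * W := by
    rw [← Matrix.mul_assoc, euclideanGamma_mul_of_ne hμν, Matrix.neg_mul, Matrix.mul_assoc, hW,
      Matrix.mul_neg, neg_neg]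
  rw [Matrix.sub_mul, Matrix.one_mul, Matrix.add_mul, Matrix.one_mul, Matrix.mul_add, hW, h1,
    two_smul]
  abel

/-- Left-nested form of `one_sub_gamma_mul_one_add_gamma_mul_of_neg`. -/
theorem one_sub_gamma_mul_one_add_gamma_mul_of_neg' {n : Type*} [Fintype n] {μ ν : Fin 4}
    (hμν : μ ≠ ν) (W : Matrix (Fin 4) n ℂ) (hW : euclideanGamma μ * W = -W) :
    ((1 : Matrix (Fin 4) (Fin 4) ℂ) - euclideanGamma μ) * (1 + euclideanGamma ν) * W =
      (2 : ℂ) • W := by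
  rw [Matrix.mul_assoc]
  exact one_sub_gamma_mul_one_add_gamma_mul_of_neg hμν W hW


/-- On `ZMod L` with `L ≤ 2` (and `L ≠ 0`) every residue is `a` or `a + 1`. -/
theorem zmod_eq_or_eq_add_one_of_le_two (hL : L ≤ 2) (z a : ZMod L) :
    z = a ∨ z = a + 1 := by
  have hv : (z - a).val < 2 := lt_of_lt_of_le (ZMod.val_lt _) hL
  have hza : ((z - a).val : ZMod L) = z - a := ZMod.natCast_zmod_val _
  interval_cases h : (z - a).val
  · left
    have : z - a = 0 := by rw [← hza]; simp
    exact sub_eq_zero.mp this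
  · right
    have : z - a = 1 := by rw [← hza]; simp
    exact eq_add_of_sub_eq' (by rw [this])

/-! ### The theorem -/

omit [NeZero L] in
/-- Height of a residue `z` in the window opened just above `c + 1`: `(z − (c+2)).val`, so that the
two layers `c, c+1` are the TOP two heights `L−2, L−1`. -/
theorem val_sub_add_one_of_le (hL : 3 ≤ L) (z c : ZMod L)
    (h : (z - c).val ≤ L - 2) : (z + 1 - c).val = (z - c).val + 1 := by
  haveI : Fact (1 < L) := ⟨by omega⟩
  have h1 : (1 : ZMod L).val = 1 := ZMod.val_one L
  rw [show z + 1 - c = (z - c) + 1 by ring, ZMod.val_add_of_lt (by rw [h1]; omega), h1]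

/-- **`stub_noCompactWilsonMode`** — Wilson fermions (`r = 1`) have no compactly supported modes,
for ANY gauge field: if `ψ` vanishes on the two layers `x μ ∈ {a, a+1}` and on the two layers
`x ν ∈ {b, b+1}` (`μ ≠ ν`), and `D_W ψ` vanishes wherever `ψ` does (eigenvectors of `D_W + V`, `V`
site-diagonal, e.g. of `H_W = γ₅ D_W`), then `ψ = 0`. -/
theorem stub_noCompactWilsonMode :
    ∀ (L N : ℕ) [NeZero L] (G : Type) [Group G] (ρ : G →* Matrix (Fin N) (Fin N) ℂ)
      (U : GaugeConfig 4 L G) (m : ℝ) (ψ : TorusSite 4 L × Fin N × Fin 4 → ℂ)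
      (μ ν : Fin 4) (a b : ZMod L), μ ≠ ν →
      (∀ x : TorusSite 4 L, (x μ = a ∨ x μ = a + 1 ∨ x ν = b ∨ x ν = b + 1) →
          ∀ (c : Fin N) (s : Fin 4), ψ (x, c, s) = 0) →
      (∀ x : TorusSite 4 L, (∀ (c : Fin N) (s : Fin 4), ψ (x, c, s) = 0) →
          ∀ (c : Fin N) (s : Fin 4), Matrix.mulVec (wilsonDirac ρ U m 1) ψ (x, c, s) = 0) →
      ψ = 0 := by
  intro L N _ G _ ρ U m ψ μ ν a b hμν hS hD
  classical
  by_cases hL2 : L ≤ 2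
  · -- small torus: the two empty layers are everything
    funext ⟨x, c, s⟩
    rcases zmod_eq_or_eq_add_one_of_le_two hL2 (x μ) a with h | h
    · exact hS x (Or.inl h) c s
    · exact hS x (Or.inr (Or.inl h)) c s
  have hL3 : 3 ≤ L := by omega
  -- colour-spin blocks
  set blk : TorusSite 4 L → Matrix (Fin 4) (Fin N) ℂ := fun z => Matrix.of fun β c => ψ (z, c, β)
    with hblk
  have hblk0 : ∀ z, (∀ c s, ψ (z, c, s) = 0) ↔ blk z = 0 := fun z => by
    constructor
    · intro h; ext β c; simp [hblk, h]
    · intro h c s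
      have := congrFun (congrFun h s) c
      simpa [hblk] using this
  -- the site equation in block form at an EMPTY site
  have hsite : ∀ y : TorusSite 4 L, blk y = 0 →
      ∑ κ : Fin 4, (((1 : Matrix (Fin 4) (Fin 4) ℂ) - euclideanGamma κ) * blk (Site.shift y κ) *
          (ρ (U (y, κ)))ᵀ +
        ((1 : Matrix (Fin 4) (Fin 4) ℂ) + euclideanGamma κ) * blk ((y - Pi.single κ 1)) *
          (ρ (U ((y - Pi.single κ 1), κ))⁻¹)ᵀ) = 0 := by
    intro y hy
    have hy' : ∀ c s, ψ (y, c, s) = 0 := (hblk0 y).mpr hy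
    ext s c
    have h := hD y hy' c s
    rw [wilsonDirac_one_mulVec_apply, hy' c s, mul_zero, zero_sub, neg_eq_zero, mul_eq_zero] at h
    rcases h with h | h
    · norm_num at h
    simp only [Matrix.sum_apply, Matrix.add_apply, Matrix.zero_apply]
    rw [← h]
    refine Finset.sum_congr rfl fun κ _ => ?_
    congr 1
    · simp only [Matrix.mul_apply, Matrix.transpose_apply, hblk, Matrix.of_apply, Finset.sum_mul]
      refine Finset.sum_congr rfl fun bb _ => Finset.sum_congr rfl fun β _ => ?_
      ring
    · simp only [Matrix.mul_apply, Matrix.transpose_apply, hblk, Matrix.of_apply, Finset.sum_mul]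
      refine Finset.sum_congr rfl fun bb _ => Finset.sum_congr rfl fun β _ => ?_
      ring
  -- invertibility of the colour transports
  have hρinv : ∀ g : G, (ρ g⁻¹)ᵀ * (ρ g)ᵀ = 1 := fun g => by
    rw [← Matrix.transpose_mul, ← map_mul, mul_inv_cancel, map_one, Matrix.transpose_one]
  -- the set of occupied sites
  set S : Finset (TorusSite 4 L) := Finset.univ.filter fun z => blk z ≠ 0 with hSdef
  have hSmem : ∀ z, z ∈ S ↔ blk z ≠ 0 := fun z => by simp [hSdef]
  have hout : ∀ z, z ∉ S → blk z = 0 := fun z hz => by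
    by_contra h; exact hz ((hSmem z).mpr h)
  by_contra hψ
  have hne : S.Nonempty := by
    by_contra hSe
    rw [Finset.not_nonempty_iff_eq_empty] at hSe
    apply hψ
    funext ⟨z, c, s⟩
    have hz : blk z = 0 := hout z (by rw [hSe]; simp)
    exact ((hblk0 z).mpr hz) c s
  -- heights
  set hμ : TorusSite 4 L → ℕ := fun z => (z μ - (a + 2)).val with hhμ
  set hν : TorusSite 4 L → ℕ := fun z => (z ν - (b + 2)).val with hhν
  have hlayer : ∀ (z c : ZMod L), (z - (c + 2)).val ≤ L - 3 ∨ z = c ∨ z = c + 1 := by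
    intro z c
    have hv : (z - (c + 2)).val < L := ZMod.val_lt _
    have hzc : (((z - (c + 2)).val : ℕ) : ZMod L) = z - (c + 2) := ZMod.natCast_zmod_val _
    by_cases h1 : (z - (c + 2)).val ≤ L - 3
    · exact Or.inl h1
    · right
      have hL0 : ((L : ℕ) : ZMod L) = 0 := ZMod.natCast_self L
      rcases (show (z - (c + 2)).val = L - 2 ∨ (z - (c + 2)).val = L - 1 by omega) with h | h
      · left
        rw [h, Nat.cast_sub (by omega), hL0, zero_sub] at hzc
        push_cast at hzc
        linear_combination -hzc
      · right
        rw [h, Nat.cast_sub (by omega), hL0, zero_sub] at hzc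
        push_cast at hzc
        linear_combination -hzc
  have hbμ : ∀ z ∈ S, hμ z ≤ L - 3 := by
    intro z hz
    rcases hlayer (z μ) a with h | h | h
    · exact h
    · exact absurd ((hblk0 z).mp (hS z (Or.inl h))) ((hSmem z).mp hz)
    · exact absurd ((hblk0 z).mp (hS z (Or.inr (Or.inl h)))) ((hSmem z).mp hz)
  have hbν : ∀ z ∈ S, hν z ≤ L - 3 := by
    intro z hz
    rcases hlayer (z ν) b with h | h | h
    · exact h
    · exact absurd ((hblk0 z).mp (hS z (Or.inr (Or.inr (Or.inl h))))) ((hSmem z).mp hz)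
    · exact absurd ((hblk0 z).mp (hS z (Or.inr (Or.inr (Or.inr h))))) ((hSmem z).mp hz)
  -- height arithmetic under shifts
  have hμ_shift_same : ∀ z, hμ z ≤ L - 2 → hμ (Site.shift z μ) = hμ z + 1 := fun z hz => by
    simp only [hhμ, shift_apply_same]
    exact val_sub_add_one_of_le hL3 _ _ hz
  have hν_shift_same : ∀ z, hν z ≤ L - 2 → hν (Site.shift z ν) = hν z + 1 := fun z hz => by
    simp only [hhν, shift_apply_same]
    exact val_sub_add_one_of_le hL3 _ _ hz
  have hμ_shift_ne : ∀ z κ, κ ≠ μ → hμ (Site.shift z κ) = hμ z := fun z κ hκ => by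
    simp only [hhμ, shift_apply_of_ne z (Ne.symm hκ)]
  have hν_shift_ne : ∀ z κ, κ ≠ ν → hν (Site.shift z κ) = hν z := fun z κ hκ => by
    simp only [hhν, shift_apply_of_ne z (Ne.symm hκ)]
  have hμ_back_ne : ∀ z κ, κ ≠ μ → hμ ((z - Pi.single κ 1)) = hμ z := fun z κ hκ => by
    simp only [hhμ, sub_single_apply_of_ne z (Ne.symm hκ)]
  have hν_back_ne : ∀ z κ, κ ≠ ν → hν ((z - Pi.single κ 1)) = hν z := fun z κ hκ => by
    simp only [hhν, sub_single_apply_of_ne z (Ne.symm hκ)]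
  -- the extremal occupied site
  obtain ⟨x₀, hx₀S, hx₀max⟩ := S.exists_max_image hμ hne
  set T : Finset (TorusSite 4 L) := S.filter fun z => hμ z = hμ x₀ with hTdef
  have hTne : T.Nonempty := ⟨x₀, by simp [hTdef, hx₀S]⟩
  obtain ⟨x, hxT, hxmax⟩ := T.exists_max_image hν hTne
  have hxS : x ∈ S := (Finset.mem_filter.mp hxT).1
  have hxμ : hμ x = hμ x₀ := (Finset.mem_filter.mp hxT).2
  have out1 : ∀ w, hμ x < hμ w → blk w = 0 := fun w hw =>
    hout w fun hwS => absurd (hx₀max w hwS) (by omega)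
  have out2 : ∀ w, hμ w = hμ x → hν x < hν w → blk w = 0 := fun w hw1 hw2 =>
    hout w fun hwS => absurd (hxmax w (Finset.mem_filter.mpr ⟨hwS, by omega⟩)) (by omega)
  have hxμb : hμ x ≤ L - 3 := hbμ x hxS
  have hxνb : hν x ≤ L - 3 := hbν x hxS
  -- STEP 1: the equation at the empty site `x + μ̂`
  set y := Site.shift x μ with hy
  have hyμ : hμ y = hμ x + 1 := hμ_shift_same x (by omega)
  have hy0 : blk y = 0 := out1 y (by omega)
  have hF1 : ∀ κ, blk (Site.shift y κ) = 0 := by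
    intro κ
    by_cases hκ : κ = μ
    · rw [hκ]; exact out1 _ (by rw [hμ_shift_same y (by omega)]; omega)
    · exact out1 _ (by rw [hμ_shift_ne y κ hκ]; omega)
  have hB1 : ∀ κ, κ ≠ μ → blk ((y - Pi.single κ 1)) = 0 := fun κ hκ =>
    out1 _ (by rw [hμ_back_ne y κ hκ]; omega)
  have hstep1 : ((1 : Matrix (Fin 4) (Fin 4) ℂ) + euclideanGamma μ) * blk x = 0 := by
    have h := hsite y hy0
    rw [Finset.sum_eq_single μ] at h
    · rw [hF1 μ, Matrix.mul_zero, Matrix.zero_mul, zero_add, hy, shift_sub_single'] at h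
      have h2 := congrArg (· * (ρ (U (x, μ)))ᵀ) h
      simpa only [Matrix.mul_assoc, hρinv, Matrix.mul_one, Matrix.zero_mul] using h2
    · intro κ _ hκ
      rw [hF1 κ, hB1 κ hκ, Matrix.mul_zero, Matrix.zero_mul, Matrix.mul_zero, Matrix.zero_mul,
        add_zero]
    · intro h; exact absurd (Finset.mem_univ μ) h
  have hneg : euclideanGamma μ * blk x = -blk x := by
    rw [Matrix.add_mul, Matrix.one_mul] at hstep1
    exact eq_neg_of_add_eq_zero_right hstep1
  -- STEP 2: the equation at the empty site `x + ν̂`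
  set y' := Site.shift x ν with hy'
  have hy'μ : hμ y' = hμ x := hμ_shift_ne x ν (Ne.symm hμν)
  have hy'ν : hν y' = hν x + 1 := hν_shift_same x (by omega)
  have hy'0 : blk y' = 0 := out2 y' hy'μ (by omega)
  have hF2 : ∀ κ, blk (Site.shift y' κ) = 0 := by
    intro κ
    by_cases hκμ : κ = μ
    · rw [hκμ]; exact out1 _ (by rw [hμ_shift_same y' (by omega)]; omega)
    by_cases hκν : κ = ν
    · rw [hκν]
      exact out2 _ (by rw [hμ_shift_ne y' ν (Ne.symm hμν), hy'μ])
        (by rw [hν_shift_same y' (by omega)]; omega)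
    · exact out2 _ (by rw [hμ_shift_ne y' κ hκμ, hy'μ]) (by rw [hν_shift_ne y' κ hκν]; omega)
  have hB2 : ∀ κ, κ ≠ μ → κ ≠ ν → blk ((y' - Pi.single κ 1)) = 0 := fun κ hκμ hκν =>
    out2 _ (by rw [hμ_back_ne y' κ hκμ, hy'μ]) (by rw [hν_back_ne y' κ hκν]; omega)
  have hstep2 : ((1 : Matrix (Fin 4) (Fin 4) ℂ) + euclideanGamma ν) * blk x * (ρ (U (x, ν))⁻¹)ᵀ +
      ((1 : Matrix (Fin 4) (Fin 4) ℂ) + euclideanGamma μ) * blk ((y' - Pi.single μ 1)) *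
        (ρ (U ((y' - Pi.single μ 1), μ))⁻¹)ᵀ = 0 := by
    have h := hsite y' hy'0
    rw [Fintype.sum_eq_add ν μ (Ne.symm hμν)] at h
    · rw [hF2 ν, hF2 μ, Matrix.mul_zero, Matrix.zero_mul, zero_add, Matrix.mul_zero,
        Matrix.zero_mul, zero_add, hy', shift_sub_single'] at h
      rw [hy']
      exact h
    · rintro κ ⟨hκν, hκμ⟩
      rw [hF2 κ, hB2 κ hκμ hκν, Matrix.mul_zero, Matrix.zero_mul, Matrix.mul_zero, Matrix.zero_mul,
        add_zero]
  -- STEP 3: kill the second term with `(1 − γ_μ)` and read off `2 blk x = 0`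
  have h3 : ((2 : ℂ) • blk x) * (ρ (U (x, ν))⁻¹)ᵀ = 0 := by
    have h := congrArg (fun M => ((1 : Matrix (Fin 4) (Fin 4) ℂ) - euclideanGamma μ) * M) hstep2
    rw [Matrix.mul_add, Matrix.mul_zero] at h
    simp only [← Matrix.mul_assoc] at h
    rw [one_sub_gamma_mul_one_add_gamma, Matrix.zero_mul, Matrix.zero_mul, add_zero,
      one_sub_gamma_mul_one_add_gamma_mul_of_neg' hμν (blk x) hneg] at h
    exact h
  have h4 : (2 : ℂ) • blk x = 0 := by
    have := congrArg (· * (ρ (U (x, ν)))ᵀ) h3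
    simpa only [Matrix.zero_mul, Matrix.mul_assoc, hρinv, Matrix.mul_one] using this
  rcases smul_eq_zero.mp h4 with h | h
  · norm_num at h
  · exact (hSmem x).mp hxS h

end NoCompactMode

end Summit.QuantumFields.QCD.Cruxes.PhaseQuenchedFlavourDecay.CrossingSplitIntegrability
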